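import Literature.Geometry.Lorentzian.EndNormSqConvex
import Literature.Geometry.Lorentzian.EndCylindricalRadius
import Literature.Geometry.Lorentzian.LevelSetMeanCurvature
import HarnessLib

/-!
# Large coordinate spheres of an asymptotically Schwarzschildean end are mean convex

Schoen–Yau, Comm. Math. Phys. 65 (1979), Appendix, p. 75: the Plateau solutions `S_σ` are kept
in the interior of `N` by the positive mean curvature of `∂N` ("the positive mean curvature of
`∂N` implies that `S_σ` lies entirely in the interior of `N`" — `div(v) > 0` on the parallel
surfaces and the divergence theorem). On a boundaryless asymptotically flat manifold the same
role is played by the **large coordinate spheres** `{|x| = Λ}` of the end, which are strictly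
mean convex: with `φ = |x|²`, the level-set formula
`H · dφ(ν) = tr_S (Hess_h φ ∘ (dF × dF))` (`LevelSetMeanCurvature.lean`) and the convexity
`Hess_h |x|² ≥ |X|²_δ` far out (Schoen–Yau's (2.4), `EndNormSqConvex.lean`:
"`D_{ij}|y|² = 2δ_{ij} + O(1/|y|)`") give `H ≥ 1/(3Λ) > 0` for the outward normal.

* `AFEnd.eventually_hCoeff_apply_self_le_two_mul` — the chart components satisfy
  `G(y)(v, v) ≤ 2‖v‖²` and `‖v‖² ≤ 2 G(y)(v, v)` far out ((1.1) with `m = 0`);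
* `AFEnd.mvfderiv_normSq_coord_apply` — `d|x|²_q(w) = 2⟨x(q), d(coord)_q w⟩`;
* `AFEnd.one_le_sum_hessian_normSq_coord` — for `q` far out and `w₁, w₂ ∈ T_q X` of unit
  `h`-length, `Hess_h |x|²(w₁, w₁) + Hess_h |x|²(w₂, w₂) ≥ 1`, and `|d|x|²(N)| ≤ 2√2 |x(q)|` for
  `N` of unit `h`-length;
* `SchoenYau.meanCurvature_coordSphere_ge` — **mean convexity of large coordinate spheres**:
  there is `ρ₀ > 0` such that for every spacelike immersed surface `F : S → X` with smooth unit
  normal `ν`, every `y₀` with `|x(F y₀)| > ρ₀` near which `|x ∘ F|²` is constant (the surface lies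
  in a coordinate sphere near `y₀`) and `d|x|²(ν_{y₀}) > 0` (outward normal),
  `H(y₀) ≥ 1/(3 |x(F y₀)|)`; in particular `H(y₀) > 0` (`SchoenYau.meanCurvature_coordSphere_pos`).

Everything is proved; no definitions, no named facts.

## References

* R. Schoen, S.-T. Yau, *On the proof of the positive mass conjecture in general relativity*,
  Comm. Math. Phys. 65 (1979) 45–76: §2 Step 2, (2.4) (p. 50: `D_{ij}|y|² = 2δ_{ij} + O(1/|y|)`),
  and Appendix, p. 75 (boundaries of positive mean curvature confine the Plateau solutions).
  [SchoenYauPMT1979]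
* G. Huisken, T. Ilmanen, *The inverse mean curvature flow and the Riemannian Penrose
  inequality*, J. Differential Geom. 59 (2001), §1, Level-Set Description, (∗∗) (mean curvature of
  level sets). [HuiskenIlmanenIMCF2001]
-/

noncomputable section

set_option maxSynthPendingDepth 3

open Bundle Set Function Filter Asymptotics Bornology Metric ContinuousLinearMap
open scoped Manifold ContDiff Topology RealInnerProductSpace

namespace Literature.Geometry.Lorentzian

open MetricCoord

namespace AFEnd

variable {X : Type} [TopologicalSpace X] [ChartedSpace E3 X] [IsManifold (𝓡 3) ∞ X]
  (e : AFEnd X) (D : InitialDataSet (𝓡 3) X)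

/-! ### Two-sided bounds for the chart components far out -/

/-- **The chart components are uniformly equivalent to `δ` far out**: under (1.1)
(`IsAsymptoticallySchwarzschild e D M 2`, any `M`), eventually along `cobounded E3`,
`‖v‖² ≤ 2 G(y)(v, v)` and `G(y)(v, v) ≤ 2‖v‖²` for all `v` (`G = (1 + M/2r)⁴ δ + O(r⁻²)` with
`(7/8)⁴ ≤ (1 + M/2r)⁴ ≤ (9/8)⁴` once `r ≥ 4|M|`). Schoen–Yau 1979, (1.1) ("`ds²` is uniformly
equivalent to the Euclidean metric", p. 63). [cite: SchoenYauPMT1979, §1 (1.1)] -/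
theorem eventually_hCoeff_apply_self_le_two_mul {M : ℝ}
    (hAS : IsAsymptoticallySchwarzschild e D M 2) :
    ∀ᶠ y in cobounded E3, ∀ v : E3,
      ‖v‖ ^ 2 ≤ 2 * hCoeff e D y v v ∧ hCoeff e D y v v ≤ 2 * ‖v‖ ^ 2 := by
  set δ : E3 →L[ℝ] E3 →L[ℝ] ℝ := (innerSL ℝ : E3 →L[ℝ] E3 →L[ℝ] ℝ) with hδdef
  have hδ : ∀ v w : E3, δ v w = ⟪v, w⟫ := fun v w ↦ rfl
  set G : E3 → E3 →L[ℝ] E3 →L[ℝ] ℝ := hCoeff e D with hGdef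
  set w : E3 → ℝ := fun y ↦ 1 + M / (2 * ‖y‖) with hwdef
  set G₀ : E3 → E3 →L[ℝ] E3 →L[ℝ] ℝ := fun y ↦ w y ^ 4 • δ with hG₀def
  have hO0 := hAS 0 (by norm_num)
  simp only [Nat.cast_zero, sub_zero] at hO0
  have hO0' : (fun x ↦ ‖G x - G₀ x‖) =O[cobounded E3] fun x ↦ ‖x‖ ^ (-(2 : ℕ) : ℝ) := by
    refine (hO0.congr_left fun x ↦ ?_).congr_right fun x ↦ by norm_num
    rw [norm_iteratedFDeriv_zero]
  have htend : Tendsto (fun x ↦ ‖G x - G₀ x‖) (cobounded E3) (𝓝 0) := by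
    refine hO0'.trans_tendsto ?_
    have h := (tendsto_rpow_neg_atTop (by norm_num : (0 : ℝ) < 2)).comp
      (tendsto_norm_cobounded_atTop (E := E3))
    refine h.congr fun x ↦ ?_
    simp only [Function.comp_apply, Nat.cast_ofNat]
  have hev_small : ∀ᶠ x in cobounded E3, ‖G x - G₀ x‖ ≤ 16⁻¹ :=
    (htend.eventually (ge_mem_nhds (by norm_num : (0 : ℝ) < 16⁻¹)))
  filter_upwards [hev_small, eventually_cobounded_le_norm (E := E3) (max 1 (4 * |M|))]
    with y hysmall hybig v
  have hy1' : 1 ≤ ‖y‖ := le_trans (le_max_left _ _) hybig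
  have hyM : 4 * |M| ≤ ‖y‖ := le_trans (le_max_right _ _) hybig
  have hypos : 0 < ‖y‖ := by linarith
  have hw_ge : 7 / 8 ≤ w y := by
    simp only [hwdef]
    have h1 : -|M| ≤ M := neg_abs_le M
    have h2 : M / (2 * ‖y‖) ≥ -(8⁻¹) := by
      rw [ge_iff_le, le_div_iff₀ (by positivity)]
      linarith
    linarith
  have hw_le : w y ≤ 9 / 8 := by
    simp only [hwdef]
    have h1 : M ≤ |M| := le_abs_self M
    have h2 : M / (2 * ‖y‖) ≤ 8⁻¹ := by
      rw [div_le_iff₀ (by positivity)]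
      linarith
    linarith
  have hwpos : 0 < w y := by linarith
  have hw4_ge : 58 / 100 ≤ w y ^ 4 := by
    have h := pow_le_pow_left₀ (by norm_num : (0 : ℝ) ≤ 7 / 8) hw_ge 4
    norm_num at h
    linarith
  have hw4_le : w y ^ 4 ≤ 17 / 10 := by
    have h := pow_le_pow_left₀ hwpos.le hw_le 4
    norm_num at h
    linarith
  have h1 : G y v v = G₀ y v v + (G y - G₀ y) v v := by
    simp only [_root_.sub_apply]; ring
  have h2 : G₀ y v v = w y ^ 4 * ‖v‖ ^ 2 := by
    rw [hG₀def, smul_clm_apply₂, hδ, real_inner_self_eq_norm_sq]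
  have h3 : |(G y - G₀ y) v v| ≤ 16⁻¹ * ‖v‖ ^ 2 := by
    calc |(G y - G₀ y) v v| ≤ ‖(G y - G₀ y) v‖ * ‖v‖ := by
          rw [← Real.norm_eq_abs]; exact le_opNorm _ _
      _ ≤ ‖G y - G₀ y‖ * ‖v‖ * ‖v‖ := by gcongr; exact le_opNorm _ _
      _ ≤ 16⁻¹ * ‖v‖ * ‖v‖ := by gcongr
      _ = 16⁻¹ * ‖v‖ ^ 2 := by ring
  have h4 := neg_abs_le ((G y - G₀ y) v v)
  have h4' := le_abs_self ((G y - G₀ y) v v)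
  have h5 := mul_le_mul_of_nonneg_right hw4_ge (sq_nonneg ‖v‖)
  have h6 := mul_le_mul_of_nonneg_right hw4_le (sq_nonneg ‖v‖)
  rw [h1, h2]
  constructor <;> nlinarith [sq_nonneg ‖v‖]

/-- **Radius form** of the two-sided bounds together with the convexity of `|y|²`
(`eventually_sq_le_hessAt_hCoeff_normSq`): one radius `τ₁ ≥ R` beyond which
`‖X‖² ≤ Hess_G |y|²(X, X)`, `‖v‖² ≤ 2G(v,v)` and `G(v,v) ≤ 2‖v‖²`.
[cite: SchoenYauPMT1979, §2 Step 2, (2.4) (p. 50)] -/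
theorem exists_radius_hessAt_normSq_and_bounds {M : ℝ}
    (hAS : IsAsymptoticallySchwarzschild e D M 2) :
    ∃ τ₁ : ℝ, e.R ≤ τ₁ ∧ ∀ y : E3, τ₁ ≤ ‖y‖ →
      (∀ X₀ : E3, ‖X₀‖ ^ 2 ≤ hessAt (hCoeff e D) (fun z : E3 ↦ ‖z‖ ^ 2) y X₀ X₀) ∧
      ∀ v : E3, ‖v‖ ^ 2 ≤ 2 * hCoeff e D y v v ∧ hCoeff e D y v v ≤ 2 * ‖v‖ ^ 2 := by
  obtain ⟨σ₀, hσ₀⟩ := exists_radius_of_eventually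
    ((e.eventually_sq_le_hessAt_hCoeff_normSq D hAS).and
      (e.eventually_hCoeff_apply_self_le_two_mul D hAS))
  exact ⟨max σ₀ e.R, le_max_right _ _, fun y hy ↦ hσ₀ y ((le_max_left _ _).trans hy)⟩

/-! ### The differential of `|x|²` and the estimates at a point of the end -/

omit [IsManifold (𝓡 3) ∞ X] in
/-- The differential of `|x|²`: `d(|coord|²)_q(w) = 2⟨coord q, d(coord)_q w⟩`. [folklore] -/
theorem mvfderiv_normSq_coord_apply {q : X} (hq : q ∈ e.U) (w : TangentSpace (𝓡 3) q) :
    mvfderiv (𝓡 3) (fun p ↦ ‖e.coord p‖ ^ 2) q w =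
      2 * ⟪e.coord q, mfderiv (𝓡 3) 𝓘(ℝ, E3) e.coord q w⟫ := by
  have hcd : MDifferentiableAt (𝓡 3) 𝓘(ℝ, E3) e.coord q :=
    (e.contMDiffAt_coord hq).mdifferentiableAt (by simp)
  have hG : MDifferentiableAt 𝓘(ℝ, E3) 𝓘(ℝ, ℝ) (fun v : E3 ↦ ‖v‖ ^ 2) (e.coord q) :=
    ((contDiff_norm_sq ℝ (n := 1)).differentiable one_ne_zero _).mdifferentiableAt
  have hcomp : mfderiv (𝓡 3) 𝓘(ℝ, ℝ) ((fun v : E3 ↦ ‖v‖ ^ 2) ∘ e.coord) q =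
      (mfderiv 𝓘(ℝ, E3) 𝓘(ℝ, ℝ) (fun v : E3 ↦ ‖v‖ ^ 2) (e.coord q)).comp
        (mfderiv (𝓡 3) 𝓘(ℝ, E3) e.coord q) := mfderiv_comp q hG hcd
  have hD : mfderiv 𝓘(ℝ, E3) 𝓘(ℝ, ℝ) (fun v : E3 ↦ ‖v‖ ^ 2) (e.coord q) =
      (2 : ℝ) • (innerSL ℝ (e.coord q) : E3 →L[ℝ] ℝ) := by
    rw [mfderiv_eq_fderiv, fderiv_norm_sq_apply, ← Nat.cast_smul_eq_nsmul ℝ]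
    norm_num
  change mfderiv (𝓡 3) 𝓘(ℝ, ℝ) ((fun v : E3 ↦ ‖v‖ ^ 2) ∘ e.coord) q w = _
  rw [hcomp, hD]
  rfl

variable [D.metric.HasLeviCivita]

/-- **The tangential Hessian of `|x|²` and the normal derivative on a coordinate sphere, at a
point far out.** Let `τ₁` be the radius of `exists_radius_hessAt_normSq_and_bounds`, `q` a point
of the end with `‖coord q‖ ≥ τ₁`, `w₁, w₂ ∈ T_q X` of unit `h`-length and `N ∈ T_q X` of unit
`h`-length. Then `Hess_h |x|²(w₁, w₁) + Hess_h |x|²(w₂, w₂) ≥ 1` and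
`|d|x|²(N)| ≤ 2√2 ‖coord q‖`: in the chart, `wₐ = dΦ Xₐ` with `1 = G(Xₐ, Xₐ) ≤ 2‖Xₐ‖²` and
`Hess_h |x|²(wₐ, wₐ) = Hess_G |y|²(Xₐ, Xₐ) ≥ ‖Xₐ‖² ≥ 1/2`; `N = dΦ N₀` with
`‖N₀‖² ≤ 2 G(N₀, N₀) = 2` and `d|x|²(N) = 2⟨y, N₀⟩`. [cite: SchoenYauPMT1979, §2 Step 2, (2.4) (p. 50)] -/
theorem one_le_sum_hessian_normSq_coord {τ₁ : ℝ}
    (hest : ∀ y : E3, τ₁ ≤ ‖y‖ →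
      (∀ X₀ : E3, ‖X₀‖ ^ 2 ≤ hessAt (hCoeff e D) (fun z : E3 ↦ ‖z‖ ^ 2) y X₀ X₀) ∧
      ∀ v : E3, ‖v‖ ^ 2 ≤ 2 * hCoeff e D y v v ∧ hCoeff e D y v v ≤ 2 * ‖v‖ ^ 2)
    {q : X} (hqU : q ∈ e.U) (hτq : τ₁ ≤ ‖e.coord q‖) (w₁ w₂ N : TangentSpace (𝓡 3) q)
    (h₁ : D.metric.val q w₁ w₁ = 1) (h₂ : D.metric.val q w₂ w₂ = 1) (hN : D.metric.val q N N = 1) :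
    1 ≤ D.metric.hessian (fun p ↦ ‖e.coord p‖ ^ 2) q w₁ w₁ +
        D.metric.hessian (fun p ↦ ‖e.coord p‖ ^ 2) q w₂ w₂ ∧
      |mvfderiv (𝓡 3) (fun p ↦ ‖e.coord p‖ ^ 2) q N| ≤
        2 * Real.sqrt 2 * ‖e.coord q‖ := by
  have hfar : q ∈ e.far e.R := e.mem_far_iff_coord.2 ⟨hqU, e.lt_norm_coord hqU⟩
  obtain ⟨z, -, rfl⟩ := e.mem_far_iff.1 hfar
  obtain ⟨X₁, rfl⟩ := e.exists_mfderiv_dataChart_eq z w₁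
  obtain ⟨X₂, rfl⟩ := e.exists_mfderiv_dataChart_eq z w₂
  obtain ⟨N₀, rfl⟩ := e.exists_mfderiv_dataChart_eq z N
  rw [e.coord_dataChart z] at hτq ⊢
  obtain ⟨hH, hbd⟩ := hest z hτq
  have hzU : e.dataChart z ∈ e.U := (e.chart.symm z).2
  -- the metric on chart directions
  rw [← e.hCoeff_apply₂_eq_metric_dataChart D z] at h₁ h₂ hN
  have hX₁ : 2⁻¹ ≤ ‖X₁‖ ^ 2 := by have := (hbd X₁).2; rw [h₁] at this; linarith
  have hX₂ : 2⁻¹ ≤ ‖X₂‖ ^ 2 := by have := (hbd X₂).2; rw [h₂] at this; linarith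
  have hN₀ : ‖N₀‖ ^ 2 ≤ 2 := by have := (hbd N₀).1; rw [hN] at this; linarith
  -- the Hessian read in the chart
  have hφ : ContMDiffAt (𝓡 3) 𝓘(ℝ, ℝ) 2 (fun p ↦ ‖e.coord p‖ ^ 2) (e.dataChart z) :=
    (e.contMDiffAt_normSq_coord hzU).of_le (WithTop.coe_le_coe.mpr le_top)
  have hrepr : ∀ y : exteriorRegion e.R,
      (fun p ↦ ‖e.coord p‖ ^ 2) (e.dataChart y) = (fun v : E3 ↦ ‖v‖ ^ 2) y := fun y ↦ by
    simp only [e.coord_dataChart]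
  have hΦr : ContDiffAt ℝ 2 (fun v : E3 ↦ ‖v‖ ^ 2) z := (contDiff_norm_sq ℝ (n := 2)).contDiffAt
  constructor
  · rw [e.hessian_dataChart_apply_eq_hessAt D z hφ hrepr hΦr X₁ X₁,
      e.hessian_dataChart_apply_eq_hessAt D z hφ hrepr hΦr X₂ X₂]
    linarith [hH X₁, hH X₂]
  · rw [e.mvfderiv_normSq_coord_apply hzU, e.mfderiv_coord_mfderiv_dataChart z N₀,
      e.coord_dataChart z, abs_mul, abs_two]
    have hCS := abs_real_inner_le_norm (z : E3) N₀
    have hN₀' : ‖N₀‖ ≤ Real.sqrt 2 := by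
      rw [← Real.sqrt_sq (norm_nonneg N₀)]
      exact Real.sqrt_le_sqrt hN₀
    calc 2 * |⟪(z : E3), N₀⟫| ≤ 2 * (‖(z : E3)‖ * ‖N₀‖) := by gcongr
      _ ≤ 2 * (‖(z : E3)‖ * Real.sqrt 2) := by gcongr
      _ = 2 * Real.sqrt 2 * ‖(z : E3)‖ := by ring

end AFEnd

namespace SchoenYau

variable {X : Type} [TopologicalSpace X] [ChartedSpace E3 X] [IsManifold (𝓡 3) ∞ X]
  (e : AFEnd X) (D : InitialDataSet (𝓡 3) X) [D.metric.HasLeviCivita]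

set_option maxHeartbeats 800000 in
/-- **Large coordinate spheres are strictly mean convex** (the barrier of Schoen–Yau 1979,
Appendix, p. 75, on a boundaryless asymptotically flat manifold). Let `(X, h, k)` be
`3`-dimensional initial data whose end `e` has the expansion (1.1)
(`IsAsymptoticallySchwarzschild e D M 2`, any `M`). There is `ρ₀ > 0` such that: for every surface
`S`, every spacelike immersion `F : S → X` with a smooth unit normal field `ν`, and every `y₀ ∈ S`
with `‖x(F y₀)‖ > ρ₀` near which `y ↦ ‖x(F y)‖²` is constant (the surface lies in the coordinate
sphere `{‖x‖ = ‖x(F y₀)‖}` near `y₀`) and for which `ν_{y₀}` points outward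
(`d‖x‖²(ν_{y₀}) > 0`), the mean curvature satisfies `H(y₀) ≥ 1 / (3 ‖x(F y₀)‖)`. Proof: by the
level-set formula (`trace_hessian_comp_eq_of_comp_eventuallyEq`, for a smooth cut-off version
`φc` of `‖x‖²`) `d‖x‖²(ν) · H = tr_S (Hess_h ‖x‖² ∘ (dF × dF)) ≥ 1`
(`one_le_sum_hessian_normSq_coord` on an `F^*h`-orthonormal basis), while
`0 < d‖x‖²(ν) ≤ 2√2 ‖x‖`. [cite: SchoenYauPMT1979, Appendix (p. 75) and §2 Step 2, (2.4)] -/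
theorem meanCurvature_coordSphere_ge {M : ℝ} (hAS : IsAsymptoticallySchwarzschild e D M 2) :
    ∃ ρ₀ : ℝ, 0 < ρ₀ ∧ ∀ (S : Type) [TopologicalSpace S]
      [ChartedSpace (EuclideanSpace ℝ (Fin 2)) S] [IsManifold (𝓡 2) ∞ S] (F : S → X)
      (hpb : PseudoRiemannianMetric.contMDiff_pullbackBilin (𝓡 3) X (𝓡 2) S ∞)
      (hfi : D.metric.IsSpacelikeImmersion (𝓡 2) F) (ν : NormalField (𝓡 3) F),
      ContMDiff (𝓡 2) (𝓡 3).tangent ∞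
          (fun y ↦ (TotalSpace.mk' E3 (F y) (ν y) : TangentBundle (𝓡 3) X)) →
      D.metric.IsUnitNormal (𝓡 2) F ν 1 →
      ∀ (y₀ : S) (c : ℝ), ρ₀ < ‖e.coord (F y₀)‖ →
        ((fun y ↦ ‖e.coord (F y)‖ ^ 2) =ᶠ[𝓝 y₀] fun _ ↦ c) →
        0 < mvfderiv (𝓡 3) (fun p ↦ ‖e.coord p‖ ^ 2) (F y₀) (ν y₀) →
        1 / (3 * ‖e.coord (F y₀)‖) ≤ D.metric.meanCurvature F hpb hfi ν y₀ := by
  obtain ⟨τ₁, hτ₁, hest⟩ := e.exists_radius_hessAt_normSq_and_bounds D hAS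
  set R₁ : ℝ := e.R + 1 with hR₁
  have hR₁' : e.R < R₁ := by rw [hR₁]; linarith
  have hRpos := e.R_pos
  refine ⟨max τ₁ (R₁ + 1), lt_max_of_lt_right (by rw [hR₁]; linarith), ?_⟩
  intro S _ _ _ F hpb hfi ν hν hun y₀ c hy₀ hlev hout
  -- the point `F y₀` lies far out in the end
  have hU : F y₀ ∈ e.U := by
    by_contra hcon
    rw [e.coord_of_not_mem hcon, norm_zero] at hy₀
    have : (0 : ℝ) < R₁ + 1 := by rw [hR₁]; linarith
    linarith [le_max_right τ₁ (R₁ + 1)]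
  have hgt₁ : R₁ + 1 < ‖e.coord (F y₀)‖ := (le_max_right _ _).trans_lt hy₀
  have hτq : τ₁ ≤ ‖e.coord (F y₀)‖ := ((le_max_left _ _).trans hy₀.le)
  have hfar : F y₀ ∈ e.far (R₁ + 1) := e.mem_far_iff_coord.2 ⟨hU, hgt₁⟩
  have hΛpos : 0 < ‖e.coord (F y₀)‖ := by
    have : (0 : ℝ) < R₁ + 1 := by rw [hR₁]; linarith
    linarith
  -- the smooth cut-off version of `|x|²`
  set φc : X → ℝ := fun p ↦ Real.smoothTransition (‖e.coord p‖ - R₁) * ‖e.coord p‖ ^ 2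
    with hφcdef
  have hφc : ContMDiff (𝓡 3) 𝓘(ℝ, ℝ) ∞ φc := by
    intro q
    by_cases hq : q ∈ ((↑) : e.U → X) '' (e.chart ⁻¹' {x | R₁ ≤ ‖(x : E3)‖})
    · obtain ⟨hqU, -⟩ := e.mem_image_preimage_le_norm_iff.1 hq
      exact ((e.contMDiff_endCutoff hR₁') q).mul (e.contMDiffAt_normSq_coord hqU)
    · refine (contMDiffAt_const (c := (0 : ℝ))).congr_of_eventuallyEq ?_
      filter_upwards [e.endCutoff_eventuallyEq_zero hR₁' hq] with p hp
      change Real.smoothTransition (‖e.coord p‖ - R₁) * ‖e.coord p‖ ^ 2 = (0 : ℝ)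
      rw [hp, zero_mul]
  have hloc : φc =ᶠ[𝓝 (F y₀)] fun p ↦ ‖e.coord p‖ ^ 2 := by
    filter_upwards [e.endCutoff_eventuallyEq_one hfar] with p hp
    change Real.smoothTransition (‖e.coord p‖ - R₁) * ‖e.coord p‖ ^ 2 = ‖e.coord p‖ ^ 2
    rw [hp, one_mul]
  -- the restriction `φc ∘ F` is constant near `y₀`
  have hFs : ContMDiff (𝓡 2) (𝓡 3) ∞ F := hfi.contMDiff_self
  have hcont : Tendsto F (𝓝 y₀) (𝓝 (F y₀)) := hFs.continuous.continuousAt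
  have hlocS : (fun y ↦ φc (F y)) =ᶠ[𝓝 y₀] fun y ↦ ‖e.coord (F y)‖ ^ 2 :=
    hcont.eventually hloc
  have hlevc : (fun y ↦ φc (F y)) =ᶠ[𝓝 y₀] fun _ ↦ c := hlocS.trans hlev
  -- the level-set formula: `tr_S (Hess φc ∘ (dF × dF)) = dφc(ν) H`
  set γ := D.metric.inducedMetric F hpb hfi with hγ
  haveI : γ.HasLeviCivita := γ.hasLeviCivita
  have hγpos : ∀ v : TangentSpace (𝓡 2) y₀, v ≠ 0 → 0 < γ.val y₀ v v := fun v hv ↦ hfi.2 y₀ v hv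
  have h2le : (2 : ℕ∞ω) ≤ ∞ := WithTop.coe_le_coe.mpr le_top
  have hdim : Module.finrank ℝ E3 = Module.finrank ℝ (EuclideanSpace ℝ (Fin 2)) + 1 := by
    rw [finrank_euclideanSpace_fin, finrank_euclideanSpace_fin]
  have htr := D.metric.trace_hessian_comp_eq_of_comp_eventuallyEq hpb hfi hν hun one_ne_zero
    hdim (hφc.of_le h2le) hlevc
  rw [div_one] at htr
  -- `dφc(ν) = d|x|²(ν) > 0` and `≤ 2√2 ‖x‖`
  have hdφ : mvfderiv (𝓡 3) φc (F y₀) (ν y₀) =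
      mvfderiv (𝓡 3) (fun p ↦ ‖e.coord p‖ ^ 2) (F y₀) (ν y₀) := by
    rw [mvfderiv_congr_of_eventuallyEq hloc]
  -- the trace on an orthonormal basis is at least `1`
  obtain ⟨b, hb⟩ := γ.exists_basis_isOrthonormalFrame (x := y₀) hγpos
    (finrank_euclideanSpace_fin (𝕜 := ℝ) (n := 2))
  have hb1 : ∀ i, D.metric.val (F y₀) (mfderiv (𝓡 2) (𝓡 3) F y₀ (b i))
      (mfderiv (𝓡 2) (𝓡 3) F y₀ (b i)) = 1 := fun i ↦ hb.1 i
  have hνν : D.metric.val (F y₀) (ν y₀) (ν y₀) = 1 := hun.2 y₀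
  obtain ⟨hsum, hdN⟩ := e.one_le_sum_hessian_normSq_coord D hest hU hτq
    (mfderiv (𝓡 2) (𝓡 3) F y₀ (b 0)) (mfderiv (𝓡 2) (𝓡 3) F y₀ (b 1)) (ν y₀) (hb1 0) (hb1 1) hνν
  have htr1 : 1 ≤ γ.trace y₀ ((D.metric.hessian φc (F y₀)).comp
      (mfderiv (𝓡 2) (𝓡 3) F y₀).toLinearMap (mfderiv (𝓡 2) (𝓡 3) F y₀).toLinearMap) := by
    rw [γ.trace_eq_sum_of_isOrthonormalFrame b hb, Fin.sum_univ_two]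
    simp only [LinearMap.BilinForm.comp_apply, ContinuousLinearMap.coe_coe]
    rw [D.metric.hessian_congr_of_eventuallyEq hloc]
    exact hsum
  -- assemble: `H = tr / dφ(ν) ≥ 1 / (2√2 ‖x‖) ≥ 1 / (3‖x‖)`
  have hd : mvfderiv (𝓡 3) (fun p ↦ ‖e.coord p‖ ^ 2) (F y₀) (ν y₀) ≤
      2 * Real.sqrt 2 * ‖e.coord (F y₀)‖ := (le_abs_self _).trans hdN
  rw [htr, hdφ] at htr1
  have hsqrt : Real.sqrt 2 < 3 / 2 := by
    rw [Real.sqrt_lt' (by norm_num)]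
    norm_num
  have hHpos : 0 < D.metric.meanCurvature F hpb hfi ν y₀ := by
    by_contra hcon
    have hle : D.metric.meanCurvature F hpb hfi ν y₀ ≤ 0 := not_lt.1 hcon
    have := mul_nonpos_of_nonneg_of_nonpos hout.le hle
    linarith
  rw [div_le_iff₀ (by positivity)]
  have h1 : 1 ≤ 2 * Real.sqrt 2 * ‖e.coord (F y₀)‖ * D.metric.meanCurvature F hpb hfi ν y₀ :=
    htr1.trans (mul_le_mul_of_nonneg_right hd hHpos.le)
  nlinarith [hHpos, hΛpos]

/-- **Large coordinate spheres are strictly mean convex** (positivity form of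
`meanCurvature_coordSphere_ge`). [cite: SchoenYauPMT1979, Appendix (p. 75)] -/
theorem meanCurvature_coordSphere_pos {M : ℝ} (hAS : IsAsymptoticallySchwarzschild e D M 2) :
    ∃ ρ₀ : ℝ, 0 < ρ₀ ∧ ∀ (S : Type) [TopologicalSpace S]
      [ChartedSpace (EuclideanSpace ℝ (Fin 2)) S] [IsManifold (𝓡 2) ∞ S] (F : S → X)
      (hpb : PseudoRiemannianMetric.contMDiff_pullbackBilin (𝓡 3) X (𝓡 2) S ∞)
      (hfi : D.metric.IsSpacelikeImmersion (𝓡 2) F) (ν : NormalField (𝓡 3) F),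
      ContMDiff (𝓡 2) (𝓡 3).tangent ∞
          (fun y ↦ (TotalSpace.mk' E3 (F y) (ν y) : TangentBundle (𝓡 3) X)) →
      D.metric.IsUnitNormal (𝓡 2) F ν 1 →
      ∀ (y₀ : S) (c : ℝ), ρ₀ < ‖e.coord (F y₀)‖ →
        ((fun y ↦ ‖e.coord (F y)‖ ^ 2) =ᶠ[𝓝 y₀] fun _ ↦ c) →
        0 < mvfderiv (𝓡 3) (fun p ↦ ‖e.coord p‖ ^ 2) (F y₀) (ν y₀) →
        0 < D.metric.meanCurvature F hpb hfi ν y₀ := by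
  obtain ⟨ρ₀, hρ₀, h⟩ := meanCurvature_coordSphere_ge e D hAS
  refine ⟨ρ₀, hρ₀, fun S _ _ _ F hpb hfi ν hν hun y₀ c hy₀ hlev hout ↦ ?_⟩
  have hge := h S F hpb hfi ν hν hun y₀ c hy₀ hlev hout
  have hΛ : 0 < ‖e.coord (F y₀)‖ := hρ₀.trans hy₀
  exact lt_of_lt_of_le (by positivity) hge

end SchoenYau

end Literature.Geometry.Lorentzian

end
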